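import Summits.FinalStateConjecture.FinalStateConjecture.Theorems.EIHFluxBalanceInertialRecessionStubEndgameToyBasics

/-!
# Route EIHFluxBalance — crux `InertialRecession`, line `sublinear-is-free-clean-window-charges`:
# the N-body CLEAN-SCALE TOY, `p = 3/2` — the empty band and the cross-pair bootstrap

Helper file for the crux `stmt-FinalStateConjecture-10166`
(`Summit.FinalStateConjecture.FinalStateConjecture.Theses.EIHFluxBalance.InertialRecession`), registered stub
`stub_pairwiseDichotomy` (lead reshape r7) of `Cruxes/InertialRecession/Lines/sublinear_is_free_clean_window_charges.lean`;
second file of the toy series (see `…ToyBasics` for the setting).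

`exists_gap_finset`: the pigeonhole EMPTY BAND for the velocity configuration of a finite set of bodies: a threshold `θ′` with
`θ/Q^{|G|²+1} ≤ θ′ ≤ θ/Q` such that every pair speed is `< θ′` or `≥ Qθ′`, whence "`< θ′`" is transitive.

`crossBootstrap` (the split phase, used by the slow-group induction `…ToyInduction` and by the top level `…ToyFrozen`): given the
level-`d` slow-group lemma as a hypothesis `hΛ`, a group whose velocity configuration at `t₁` has an empty band with classes of
size `≤ d` keeps every member within `12θ′ + 12dθ_g` of its velocity at `t₁`: a nested first-exit bootstrap
(`bootstrap_principle`) over the cross pairs — while each stays within `W/2` of its initial relative velocity it is ballistic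
(`speed_of_deviation`, `ballistic_majorant`, budget `≤ m_min ε₀` by lateness), so `hΛ` applies to every class with the majorant
`φ′ = φ + Σψ` and bounds the member drifts by `12θ′ + 12dθ_g ≤ 25θ′/2`, i.e. the cross deviations by `25θ′ ≤ W/16 < W/2`.

References: D. Saari, Trans. AMS 156 (1971) 219–240; C. Marchal, D. Saari, J. Differential Equations 20 (1976) 150–186.
-/

noncomputable section

set_option linter.dupNamespace false

open Filter Topology Set MeasureTheory intervalIntegral
open scoped Topology BigOperators

namespace Summit.FinalStateConjecture.FinalStateConjecture.Theorems.SublinearIsFree.Toy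

open Literature.Geometry.Lorentzian
open Summit.FinalStateConjecture.FinalStateConjecture.Theorems.SublinearIsFree.Endgame

/-! ### The empty band for a finite set of bodies -/

/-- **EMPTY BAND for a finite velocity configuration.** For a finite index set `G`, vectors `u k` and `θ > 0`, `Q ≥ 2`, there
is `θ′ ∈ [θ/Q^{|G|²+1}, θ/Q]` such that every pair speed inside `G` is `< θ′` or `≥ Qθ′`; consequently "`< θ′`" is transitive
on `G`. [folklore] -/
theorem exists_gap_finset {ι E : Type*} [SeminormedAddCommGroup E] (G : Finset ι) (u : ι → E) {θ Q : ℝ}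
    (hθ : 0 < θ) (hQ : 2 ≤ Q) :
    ∃ θ' : ℝ, θ / Q ^ (G.card * G.card + 1) ≤ θ' ∧ θ' ≤ θ / Q ∧ 0 < θ' ∧
      (∀ k ∈ G, ∀ l ∈ G, ‖u k - u l‖ < θ' ∨ Q * θ' ≤ ‖u k - u l‖) ∧
      (∀ k ∈ G, ∀ l ∈ G, ∀ j ∈ G, ‖u k - u l‖ < θ' → ‖u l - u j‖ < θ' → ‖u k - u j‖ < θ') := by
  classical
  have hQ1 : 1 < Q := by linarith
  have hQ0 : 0 < Q := by linarith
  set s : Finset ℝ := (G ×ˢ G).image fun p ↦ ‖u p.1 - u p.2‖ with hs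
  obtain ⟨j, hj, hfree⟩ := exists_emptyBand s hθ hQ1
  have hcard : s.card ≤ G.card * G.card := by
    calc s.card ≤ (G ×ˢ G).card := Finset.card_image_le
      _ = G.card * G.card := Finset.card_product _ _
  have hband : ∀ k ∈ G, ∀ l ∈ G, ¬ (θ / Q ^ (j + 1) ≤ ‖u k - u l‖ ∧ ‖u k - u l‖ < Q * (θ / Q ^ (j + 1))) := by
    intro k hk l hl h
    have hmem : ‖u k - u l‖ ∈ s := Finset.mem_image.mpr ⟨(k, l), Finset.mem_product.mpr ⟨hk, hl⟩, rfl⟩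
    refine hfree _ hmem ⟨h.1, ?_⟩
    have : Q * (θ / Q ^ (j + 1)) = θ / Q ^ j := by rw [pow_succ]; field_simp
    rw [← this]; exact h.2
  have hdich : ∀ k ∈ G, ∀ l ∈ G, ‖u k - u l‖ < θ / Q ^ (j + 1) ∨ Q * (θ / Q ^ (j + 1)) ≤ ‖u k - u l‖ := by
    intro k hk l hl
    by_contra hh
    push Not at hh
    exact hband k hk l hl ⟨hh.1, hh.2⟩
  refine ⟨θ / Q ^ (j + 1), ?_, ?_, by positivity, hdich, ?_⟩
  · refine div_le_div_of_nonneg_left hθ.le (pow_pos hQ0 _) (pow_le_pow_right₀ hQ1.le (by omega))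
  · refine div_le_div_of_nonneg_left hθ.le hQ0 ?_
    calc Q = Q ^ 1 := (pow_one Q).symm
      _ ≤ Q ^ (j + 1) := pow_le_pow_right₀ hQ1.le (by omega)
  · intro k hk l hl i hi hkl hli
    have htri : ‖u k - u i‖ ≤ ‖u k - u l‖ + ‖u l - u i‖ := norm_sub_le_norm_sub_add_norm_sub _ _ _
    have hpos : 0 < θ / Q ^ (j + 1) := by positivity
    rcases hdich k hk i hi with h | h
    · exact h
    · nlinarith

/-- Exponent bookkeeping for the thresholds: `d³ + d + ((d+1)² + 1) ≤ (d+1)³ + (d+1)`. [folklore] -/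
theorem level_exponent_le (d : ℕ) : d ^ 3 + d + ((d + 1) ^ 2 + 1) ≤ (d + 1) ^ 3 + (d + 1) := by
  have : (d + 1) ^ 3 + (d + 1) = d ^ 3 + d + ((d + 1) ^ 2 + 1) + (2 * d ^ 2 + d) := by ring
  omega

/-! ### Lemma Λ: slow groups under ballistic outsiders -/

set_option maxHeartbeats 800000 in
/-- **THE CROSS-PAIR BOOTSTRAP (split phase).** Given the level-`d` slow-group lemma `hΛ`, a finite group `G` whose velocity
configuration at time `t₁ ≥ T` has an EMPTY BAND (`< θ′` or `≥ 400θ′`, "`< θ′`" transitive on `G`) with classes of size `≤ d`,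
`θ′` above the level-`d` threshold, and a continuous outsider majorant `φ ≥ 0` whose budget leaves room for `N²` ballistic
quanta: every member of `G` drifts by at most `12θ′ + 12dθ_g` on `[t₁, u]`. Proof: first-exit bootstrap (`bootstrap_principle`)
over the cross pairs — while each stays within `W/2` of its initial relative velocity it is ballistic, its majorant `ψ` has
budget `≤ m_min ε₀`, so `hΛ` applies to every class with `φ′ = φ + Σψ` and bounds the member drifts by `12θ′ + 12dθ_g ≤ 25θ′/2`,
whence the cross deviations are `≤ 25θ′ ≤ W/16 < W/2`. [folklore] -/
theorem crossBootstrap {N n : ℕ} {ξ v a : Fin N → ℝ → (Fin n → ℝ)}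
    {K T A mmin θg ε₀ : ℝ}
    (hK : 0 ≤ K)
    (hξ : ∀ i t, HasDerivAt (ξ i) (v i t) t) (hv : ∀ i t, HasDerivAt (v i) (a i t) t)
    (hA : 0 < A)
    (hfar : ∀ i j, i ≠ j → ∀ t, T ≤ t → A ≤ ‖ξ i t - ξ j t‖)
    (hθg : 0 < θg) (hε₀ : 0 ≤ ε₀) (hmmin : 0 < mmin)
    (hE1 : K * (2 * √2 * (8 / (θg * √A))) ≤ mmin * ε₀)
    [Nonempty (Fin n)] {d : ℕ}
    (hΛ : ∀ (G : Finset (Fin N)), G.card ≤ d → G.Nonempty →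
      ∀ (a₀ u θ : ℝ) (φ : ℝ → ℝ), T ≤ a₀ → a₀ ≤ u → 24 * (N + d) * θg * 400 ^ (d ^ 3 + d) ≤ θ →
      (∀ k ∈ G, ∀ l ∈ G, ‖v k a₀ - v l a₀‖ ≤ θ) →
      Continuous φ → (∀ s, 0 ≤ φ s) →
      (∀ s ∈ Icc a₀ u, ∀ i ∈ G, ∀ j ∉ G, (‖ξ i s - ξ j s‖ * √‖ξ i s - ξ j s‖)⁻¹ ≤ φ s) →
      K * (∫ s in a₀..u, φ s) ≤ mmin * (10 * θg + (N - d) * (N ^ 2 * ε₀)) →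
      ∀ t ∈ Icc a₀ u, ∀ k ∈ G, ‖v k t - v k a₀‖ ≤ 12 * θ + 12 * d * θg)
    {G : Finset (Fin N)} {t₁ u θ' : ℝ} {φ : ℝ → ℝ} (hTt₁ : T ≤ t₁) (ht₁u : t₁ ≤ u) (hθ'pos : 0 < θ')
    (hdich : ∀ k ∈ G, ∀ l ∈ G, ‖v k t₁ - v l t₁‖ < θ' ∨ 400 * θ' ≤ ‖v k t₁ - v l t₁‖)
    (htrans : ∀ k ∈ G, ∀ l ∈ G, ∀ j ∈ G, ‖v k t₁ - v l t₁‖ < θ' → ‖v l t₁ - v j t₁‖ < θ' → ‖v k t₁ - v j t₁‖ < θ')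
    (hθ'ge : 24 * (N + d) * θg * 400 ^ (d ^ 3 + d) ≤ θ')
    (hcls_card : ∀ k ∈ G, (G.filter fun l ↦ ‖v k t₁ - v l t₁‖ < θ').card ≤ d)
    (hφc : Continuous φ) (hφ0 : ∀ s, 0 ≤ φ s)
    (hφ : ∀ s ∈ Icc t₁ u, ∀ i ∈ G, ∀ j ∉ G, (‖ξ i s - ξ j s‖ * √‖ξ i s - ξ j s‖)⁻¹ ≤ φ s)
    (hbud : K * (∫ s in t₁..u, φ s) + mmin * (N ^ 2 * ε₀) ≤ mmin * (10 * θg + (N - d) * (N ^ 2 * ε₀))) :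
    ∀ k ∈ G, ∀ s ∈ Icc t₁ u, ‖v k s - v k t₁‖ ≤ 12 * θ' + 12 * d * θg := by
  classical
  have hvc : ∀ i, Continuous (v i) := fun i ↦ continuous_iff_continuousAt.mpr fun t ↦ (hv i t).continuousAt
  -- make the base `400` opaque
  generalize hQgen : (400 : ℝ) = Q at hdich hθ'ge hΛ
  have hQ1 : (1 : ℝ) ≤ Q := by rw [← hQgen]; norm_num
  have hNθ' : 24 * (N + d) * θg ≤ θ' := by
    have h1 : (1 : ℝ) ≤ Q ^ (d ^ 3 + d) := one_le_pow₀ hQ1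
    have h0 : 0 ≤ 24 * ((N : ℝ) + d) * θg := by positivity
    have := mul_le_mul_of_nonneg_left h1 h0
    linarith only [this, hθ'ge]
  -- classes
  set cls : Fin N → Finset (Fin N) := fun k ↦ G.filter fun l ↦ ‖v k t₁ - v l t₁‖ < θ' with hcls
  have hcls_sub : ∀ k, cls k ⊆ G := fun k ↦ Finset.filter_subset _ _
  have hmem_cls : ∀ k ∈ G, k ∈ cls k := fun k hk ↦
    Finset.mem_filter.mpr ⟨hk, by simp [hθ'pos]⟩
  have hcls_slow : ∀ k ∈ G, ∀ k' ∈ cls k, ∀ l' ∈ cls k, ‖v k' t₁ - v l' t₁‖ < θ' := by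
    intro k hk k' hk' l' hl'
    have h1 := (Finset.mem_filter.mp hk')
    have h2 := (Finset.mem_filter.mp hl')
    have h1' : ‖v k' t₁ - v k t₁‖ < θ' := by rw [norm_sub_rev]; exact h1.2
    exact htrans k' h1.1 k hk l' h2.1 h1' h2.2
  -- cross pairs (ordered), their speeds and ballistic coordinates at `t₁`
  set I : Finset (Fin N × Fin N) := (G ×ˢ G).filter fun p ↦ θ' ≤ ‖v p.2 t₁ - v p.1 t₁‖ with hI
  have hI_fast : ∀ p ∈ I, 400 * θ' ≤ ‖v p.2 t₁ - v p.1 t₁‖ := by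
    intro p hp
    have h := Finset.mem_filter.mp hp
    have hG2 := Finset.mem_product.mp h.1
    rcases hdich p.2 hG2.2 p.1 hG2.1 with h' | h'
    · linarith [h.2]
    · rw [← hQgen] at h'
      exact h'
  have hI_pos : ∀ p ∈ I, 0 < ‖v p.2 t₁ - v p.1 t₁‖ := fun p hp ↦ by
    have := hI_fast p hp; nlinarith
  have hcoord : ∀ p ∈ I, ∃ (ℓ : Fin n) (σ : ℝ), (σ = 1 ∨ σ = -1) ∧
      σ * (v p.2 t₁ - v p.1 t₁) ℓ = ‖v p.2 t₁ - v p.1 t₁‖ := fun p hp ↦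
    exists_sign_coord _ (hI_pos p hp)
  choose! ℓ σ hσ hσW using hcoord
  -- the ballistic majorants
  set ψ : Fin N × Fin N → ℝ → ℝ := fun p s ↦
    2 * √2 * ((|σ p * (ξ p.2 s - ξ p.1 s) (ℓ p)| + A) * √(|σ p * (ξ p.2 s - ξ p.1 s) (ℓ p)| + A))⁻¹ with hψ
  have hψ0 : ∀ p s, 0 ≤ ψ p s := fun p s ↦ by positivity
  have hξc : ∀ i, Continuous (ξ i) := fun i ↦ continuous_iff_continuousAt.mpr fun t ↦ (hξ i t).continuousAt
  have hψc : ∀ p, Continuous (ψ p) := by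
    intro p
    have hxc : Continuous fun s ↦ σ p * (ξ p.2 s - ξ p.1 s) (ℓ p) :=
      continuous_const.mul ((continuous_apply (ℓ p)).comp ((hξc p.2).sub (hξc p.1)))
    have hq : ∀ s, 0 < |σ p * (ξ p.2 s - ξ p.1 s) (ℓ p)| + A := fun s ↦ by positivity
    have hc : Continuous fun s ↦ |σ p * (ξ p.2 s - ξ p.1 s) (ℓ p)| + A := hxc.abs.add continuous_const
    refine continuous_const.mul ((hc.mul hc.sqrt).inv₀ fun s ↦ ?_)
    exact (mul_pos (hq s) (Real.sqrt_pos.mpr (hq s))).ne'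
  set φ' : ℝ → ℝ := fun s ↦ φ s + ∑ p ∈ I, ψ p s with hφ'
  have hφ'c : Continuous φ' := hφc.add (continuous_finsetSum _ fun p _ ↦ hψc p)
  have hφ'0 : ∀ s, 0 ≤ φ' s := fun s ↦ add_nonneg (hφ0 s) (Finset.sum_nonneg fun p _ ↦ hψ0 p s)
  -- membership facts for cross pairs
  have hcross_mem : ∀ k ∈ G, ∀ i ∈ cls k, ∀ j ∈ G, j ∉ cls k → (i, j) ∈ I := by
    intro k hk i hi j hj hjn
    have hi' := Finset.mem_filter.mp hi
    refine Finset.mem_filter.mpr ⟨Finset.mem_product.mpr ⟨hi'.1, hj⟩, ?_⟩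
    by_contra h
    push Not at h
    -- `‖v j − v i‖ < θ'` and `‖v k − v i‖ < θ'` give `‖v k − v j‖ < θ'`, contradiction
    have h1 : ‖v i t₁ - v j t₁‖ < θ' := by rw [norm_sub_rev]; exact h
    have h2 : ‖v k t₁ - v j t₁‖ < θ' := htrans k hk i hi'.1 j hj hi'.2 h1
    exact hjn (Finset.mem_filter.mpr ⟨hj, h2⟩)
  -- THE INNER DERIVATION: weak ballistic bounds for the cross pairs on `[t₁, u']` ⇒ class drifts via the induction hypothesis
  have inner : ∀ u' ∈ Icc t₁ u,
      (∀ p ∈ I, ∀ s ∈ Icc t₁ u', ‖(v p.2 s - v p.1 s) - (v p.2 t₁ - v p.1 t₁)‖ ≤ ‖v p.2 t₁ - v p.1 t₁‖ / 2) →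
      ∀ k ∈ G, ∀ s ∈ Icc t₁ u', ‖v k s - v k t₁‖ ≤ 12 * θ' + 12 * d * θg := by
    intro u' hu' hweak k hk s hs
    -- ballistic geometry of every cross pair on `[t₁, u']`
    have hspeed : ∀ p ∈ I, ∀ s ∈ Icc t₁ u', ‖v p.2 t₁ - v p.1 t₁‖ / 2 ≤ σ p * (v p.2 s - v p.1 s) (ℓ p) :=
      fun p hp s hs ↦ speed_of_deviation (hσ p hp) (hσW p hp) (hweak p hp s hs)
    have hballistic : ∀ p ∈ I,
        (∀ s ∈ Icc t₁ u', (‖ξ p.2 s - ξ p.1 s‖ * √‖ξ p.2 s - ξ p.1 s‖)⁻¹ ≤ ψ p s) ∧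
        ∫ s in t₁..u', ψ p s ≤ 2 * √2 * (8 / (‖v p.2 t₁ - v p.1 t₁‖ * √A)) := by
      intro p hp
      have hne : p.2 ≠ p.1 := by
        intro h
        have := hI_pos p hp
        rw [h, sub_self, norm_zero] at this
        exact lt_irrefl _ this
      have hfarp : ∀ s ∈ Icc t₁ u', A ≤ ‖ξ p.2 s - ξ p.1 s‖ := fun s hs ↦
        hfar p.2 p.1 hne s (hTt₁.trans hs.1)
      obtain ⟨-, -, h3, h4⟩ := ballistic_majorant hξ hvc (hσ p hp) (hI_pos p hp) hA hu'.1 (hspeed p hp) hfarp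
      exact ⟨h3, h4⟩
    -- budgets of the majorants
    have hψbud : ∀ p ∈ I, K * ∫ s in t₁..u', ψ p s ≤ mmin * ε₀ := by
      intro p hp
      have h1 := (hballistic p hp).2
      have hW : θg ≤ ‖v p.2 t₁ - v p.1 t₁‖ := by
        have := hI_fast p hp
        have hd0 : (0 : ℝ) ≤ d := by positivity
        have hN1 : (1 : ℝ) ≤ N := by
          have : 0 < N := Fin.pos p.1
          exact_mod_cast this
        have h24 : θg ≤ 24 * (N + d) * θg := by nlinarith [hN1, hd0, hθg]
        linarith
      have h2 : 2 * √2 * (8 / (‖v p.2 t₁ - v p.1 t₁‖ * √A)) ≤ 2 * √2 * (8 / (θg * √A)) := by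
        gcongr
      calc K * ∫ s in t₁..u', ψ p s ≤ K * (2 * √2 * (8 / (θg * √A))) :=
            mul_le_mul_of_nonneg_left (h1.trans h2) hK
        _ ≤ mmin * ε₀ := hE1
    have hIcard : (I.card : ℝ) ≤ N ^ 2 := by
      have h1 : I.card ≤ (G ×ˢ G).card := Finset.card_filter_le _ _
      have h2 : (G ×ˢ G).card = G.card * G.card := Finset.card_product _ _
      have h3 : G.card ≤ N := by
        calc G.card ≤ (Finset.univ : Finset (Fin N)).card := Finset.card_le_univ G
          _ = N := by simp
      have h4 : I.card ≤ N * N := by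
        calc I.card ≤ G.card * G.card := by rw [← h2]; exact h1
          _ ≤ N * N := Nat.mul_le_mul h3 h3
      have : ((I.card : ℕ) : ℝ) ≤ ((N * N : ℕ) : ℝ) := by exact_mod_cast h4
      simpa [sq] using this
    have hφ'bud : K * (∫ s in t₁..u', φ' s) ≤ mmin * (10 * θg + (N - d) * (N ^ 2 * ε₀)) := by
      have hsplit : ∫ s in t₁..u', φ' s = (∫ s in t₁..u', φ s) + ∑ p ∈ I, ∫ s in t₁..u', ψ p s := by
        simp only [hφ']
        rw [intervalIntegral.integral_add (hφc.intervalIntegrable _ _)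
          ((continuous_finsetSum _ fun p _ ↦ hψc p).intervalIntegrable _ _)]
        rw [intervalIntegral.integral_finsetSum fun p _ ↦ (hψc p).intervalIntegrable _ _]
      have hmono : ∫ s in t₁..u', φ s ≤ ∫ s in t₁..u, φ s :=
        intervalIntegral.integral_mono_interval le_rfl hu'.1 hu'.2 (Eventually.of_forall fun x ↦ hφ0 x)
          (hφc.intervalIntegrable _ _)
      have hsum : K * ∑ p ∈ I, ∫ s in t₁..u', ψ p s ≤ I.card * (mmin * ε₀) := by
        rw [Finset.mul_sum]
        calc ∑ p ∈ I, K * ∫ s in t₁..u', ψ p s ≤ ∑ p ∈ I, mmin * ε₀ := Finset.sum_le_sum hψbud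
          _ = I.card * (mmin * ε₀) := by rw [Finset.sum_const, nsmul_eq_mul]
      have hK1 := mul_le_mul_of_nonneg_left hmono hK
      have hme : 0 ≤ mmin * ε₀ := by positivity
      have hcardε : (I.card : ℝ) * (mmin * ε₀) ≤ N ^ 2 * (mmin * ε₀) := mul_le_mul_of_nonneg_right hIcard hme
      calc K * ∫ s in t₁..u', φ' s = K * (∫ s in t₁..u', φ s) + K * ∑ p ∈ I, ∫ s in t₁..u', ψ p s := by
            rw [hsplit, mul_add]
        _ ≤ K * (∫ s in t₁..u, φ s) + mmin * (N ^ 2 * ε₀) := by linarith only [hK1, hsum, hcardε]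
        _ ≤ mmin * (10 * θg + (N - d) * (N ^ 2 * ε₀)) := hbud
    -- the induction hypothesis for the class of `k`
    have hmaj : ∀ s' ∈ Icc t₁ u', ∀ i ∈ cls k, ∀ j ∉ cls k,
        (‖ξ i s' - ξ j s'‖ * √‖ξ i s' - ξ j s'‖)⁻¹ ≤ φ' s' := by
      intro s' hs' i hi j hj
      have hs'' : s' ∈ Icc t₁ u := ⟨hs'.1, hs'.2.trans hu'.2⟩
      by_cases hjG : j ∈ G
      · -- a cross pair inside `G`: use its ballistic majorant
        have hp : (i, j) ∈ I := hcross_mem k hk i hi j hjG hj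
        have h1 := (hballistic (i, j) hp).1 s' hs'
        have h2 : ψ (i, j) s' ≤ ∑ p ∈ I, ψ p s' :=
          Finset.single_le_sum (fun p _ ↦ hψ0 p s') hp
        have h3 : (‖ξ i s' - ξ j s'‖ * √‖ξ i s' - ξ j s'‖)⁻¹ = (‖ξ j s' - ξ i s'‖ * √‖ξ j s' - ξ i s'‖)⁻¹ := by
          rw [norm_sub_rev]
        rw [h3]
        calc (‖ξ j s' - ξ i s'‖ * √‖ξ j s' - ξ i s'‖)⁻¹ ≤ ψ (i, j) s' := h1
          _ ≤ φ' s' := by simp only [hφ']; linarith [hφ0 s']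
      · -- an outsider of `G`
        have h1 := hφ s' hs'' i (hcls_sub k hi) j hjG
        have h2 : 0 ≤ ∑ p ∈ I, ψ p s' := Finset.sum_nonneg fun p _ ↦ hψ0 p s'
        simp only [hφ']; linarith
    have hIH := hΛ (cls k) (hcls_card k hk) ⟨k, hmem_cls k hk⟩ t₁ u' θ' φ' hTt₁ hu'.1 hθ'ge
      (fun k' hk' l' hl' ↦ (hcls_slow k hk k' hk' l' hl').le) hφ'c hφ'0 hmaj hφ'bud s hs k (hmem_cls k hk)
    exact hIH
  -- THE NESTED BOOTSTRAP on `[t₁, u]`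
  have hboot : ∀ p ∈ I, ∀ s ∈ Icc t₁ u,
      ‖(v p.2 s - v p.1 s) - (v p.2 t₁ - v p.1 t₁)‖ ≤ ‖v p.2 t₁ - v p.1 t₁‖ / 4 := by
    refine bootstrap_principle I (fun p s ↦ ‖(v p.2 s - v p.1 s) - (v p.2 t₁ - v p.1 t₁)‖)
      (fun p ↦ ‖v p.2 t₁ - v p.1 t₁‖ / 2) (fun p ↦ ‖v p.2 t₁ - v p.1 t₁‖ / 4) ht₁u
      (fun p _ ↦ (((hvc p.2).sub (hvc p.1)).sub continuous_const).norm)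
      (fun p hp ↦ by linarith [hI_pos p hp]) (fun p hp ↦ by simp; positivity) ?_
    intro u' hu' hweak p hp s hs
    have hG2 := Finset.mem_product.mp (Finset.mem_filter.mp hp).1
    have h1 := inner u' hu' hweak p.1 hG2.1 s hs
    have h2 := inner u' hu' hweak p.2 hG2.2 s hs
    have hdθ : 12 * (d : ℝ) * θg ≤ θ' / 2 := by
      have hN0 : (0 : ℝ) ≤ N := by positivity
      nlinarith
    calc ‖(v p.2 s - v p.1 s) - (v p.2 t₁ - v p.1 t₁)‖ = ‖(v p.2 s - v p.2 t₁) - (v p.1 s - v p.1 t₁)‖ := by abel_nf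
      _ ≤ ‖v p.2 s - v p.2 t₁‖ + ‖v p.1 s - v p.1 t₁‖ := norm_sub_le _ _
      _ ≤ 2 * (12 * θ' + 12 * d * θg) := by linarith
      _ ≤ 25 * θ' := by linarith
      _ ≤ ‖v p.2 t₁ - v p.1 t₁‖ / 4 := by linarith [hI_fast p hp]
  -- consequently the class drifts hold on all of `[t₁, u]`
  intro k hk s hs
  exact inner u ⟨ht₁u, le_rfl⟩ (fun p hp s hs ↦ (hboot p hp s hs).trans (by linarith [hI_pos p hp])) k hk s hs

/-- Registered helper form of `exists_gap_finset` for velocity configurations in `ℝⁿ` (the empty band). [folklore] -/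
theorem endgame_toy_gap : ∀ (N n : ℕ) (G : Finset (Fin N)) (u : Fin N → (Fin n → ℝ)) (θ Q : ℝ), 0 < θ → 2 ≤ Q → ∃ θ' : ℝ, θ / Q ^ (G.card * G.card + 1) ≤ θ' ∧ θ' ≤ θ / Q ∧ 0 < θ' ∧ (∀ k ∈ G, ∀ l ∈ G, ‖u k - u l‖ < θ' ∨ Q * θ' ≤ ‖u k - u l‖) ∧ (∀ k ∈ G, ∀ l ∈ G, ∀ j ∈ G, ‖u k - u l‖ < θ' → ‖u l - u j‖ < θ' → ‖u k - u j‖ < θ') :=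
  fun _ _ G u _ _ hθ hQ ↦ exists_gap_finset G u hθ hQ

end Summit.FinalStateConjecture.FinalStateConjecture.Theorems.SublinearIsFree.Toy

end
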